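import Literature.Barriers.NavierStokesRegularity.ComplexNavierStokesBlowupSeries
import HarnessLib

/-!
# Li–Sinai complex Navier–Stokes blow-up: uniqueness of one-sided solutions, exact residual, restart law

Eighth file of the barrier entry `ComplexNavierStokesBlowup` (D-0021), companion of
`ComplexNavierStokesBlowupSeries.lean` (the power series (3) of D. Li, Ya. G. Sinai, *Blow ups of
complex solutions of the 3D Navier–Stokes system and renormalization group method*, J. Eur. Math.
Soc. 10 (2008) 267–313, §2, PROVED there to solve the integral equation (1) at ALL times for every
bounded measurable datum vanishing off `{a ≤ k₃, |k| ≤ R}`, `a > 0`). Everything in this file is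
PROVED; no new fact is stated. (`k 2` is the third coordinate `k₃` of `k : ℝ³`.)

## What is here

* **Triangular uniqueness** `SolvesFourierNSAt.unique_of_oneSided` (remark, ours; the source
  works with the power series only and never raises the question). Call `v : ℝ → ℝ³ → ℝ³`
  ONE-SIDED (with margin `a > 0`) on `[0,t)` if `v(k,τ) = 0` whenever `k₃ < a`. Two one-sided
  solutions of Li–Sinai's integral equation (1) [LiSinai2008, §1 eq. (1) p. 268]
  (`SolvesFourierNSAt` at every `τ ∈ [0,t)` and every `k ≠ 0`, honest integrals) with the same
  datum coincide on `[0,t)`. Proof: in the interaction integrand `⟨v(k-k',s),k⟩ P_k v(k',s)` at a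
  wave vector with `k₃ < (N+1)a` a factor vanishes unless `k'₃ ≥ a` and `k₃ - k'₃ ≥ a`, and then
  both arguments lie in the slab `{k₃ < N a}`; so equality of the two solutions on the slab
  `{k₃ < N a}` propagates, through the right-hand side of (1), to the slab `{k₃ < (N+1) a}` —
  the same triangular structure that makes the power series a finite sum at each `k`
  (`supp g_p ⊆ C + ⋯ + C`, [LiSinai2008, §2 p. 270]). No size condition, no integrability beyond
  the clauses of `SolvesFourierNSAt`, no continuity in time is needed.
* **The series is THE one-sided solution** `eq_seriesSolution_of_oneSided`: a one-sided solution
  of (1) on `[0,t)` issuing from a bounded measurable datum vanishing off `{a ≤ k₃, |k| ≤ R}` is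
  Li–Sinai's power series `LiSinai.seriesSolution v₀` there (which is one-sided and solves (1),
  `LiSinai.seriesSolution_solvesFourierNSAt`).
* **The exact residual of the barrier on Li–Sinai's class**
  `complexNavierStokesBlowup_of_seriesEnergy_tendsto` and `complexNavierStokesBlowup_oneSided_iff`:
  the catalogue fact `ComplexNavierStokesBlowup` asks for finite energy on `[0,t)` and
  `E(τ) → ∞` as `τ ↑ t` (the Fatou reading of "at `t' = t` they become infinite",
  [LiSinai2008, §1 p. 268 and §10 p. 312]). For witnesses in Li–Sinai's class — datum vanishing
  off `{k₃ ≥ a}` for some `a > 0` ("supported in a neighbourhood of `(0,0,k⁽⁰⁾)`", §1 p. 268,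
  data (39) §7 p. 295) and solution one-sided — this is EQUIVALENT to the same energy profile of
  the explicit all-time solution `seriesSolution v₀` of one admissible datum: there is no freedom
  in the choice of the solution. (The in-tree sufficient condition `LiSinaiSeriesEnergyBlowup`
  — infinite energy AT `t` — implies this profile by Fatou,
  `LiSinaiSeriesEnergyBlowup.complexNavierStokesBlowup`; the profile itself, "`E(τ) → ∞` as
  `τ ↑ t` with `E` finite before", is what the fact literally requires.)

* **Restart (semigroup) law of the series** `LiSinai.seriesSolution_add`: for an admissible datum
  and `t₀, τ ≥ 0`, `seriesSolution v₀ (t₀ + τ) = seriesSolution (seriesSolution v₀ t₀) τ` — the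
  power series re-expanded around the time-`t₀` slice reproduces the solution (the source expands
  around `t = 0` only). Ingredients, all proved here: the Duhamel algebra of a time shift for the
  integral equation (1) (`SolvesFourierNSAt.shift`: a solution at times `t₀` and `t₀ + τ` is,
  shifted, a solution at time `τ` from the datum `v(·,t₀)`); LOCALITY of the modes and of the
  series (`LiSinai.mode_congr_below`, `LiSinai.seriesSolution_congr_below`: on `{k₃ < L}` they
  depend on the datum only below `L`, by the same support bookkeeping); hence the series issued
  from the slice `seriesSolution v₀ t₀` — a datum neither bounded nor compactly supported, but
  admissible after truncation to any slab (`LiSinai.indicator_seriesSolution_admissible`) — is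
  one-sided and solves (1) at all times (`LiSinai.seriesSolution_restart_solvesFourierNSAt`);
  and triangular uniqueness.

Nothing here proves a lower bound on the energy; the unproved core of the barrier (Theorem 1 of
the source, p. 311, with the computer-numerical steps of §7 p. 302, used in §10 p. 312) is
untouched.

## References

* D. Li, Ya. G. Sinai, J. Eur. Math. Soc. 10 (2008) 267–313: §1 p. 268 (eq. (1)), §2 p. 269–270
  (eqs. (3)–(6), `supp g_p`), §7 p. 295, p. 302, Thm. 1 p. 311, §10 p. 312. [`LiSinai2008`]
-/

noncomputable section

open MeasureTheory Set Filter Topology Finset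
open scoped ENNReal InnerProductSpace RealInnerProductSpace BigOperators

namespace Literature.Barriers.NavierStokesRegularity

/-- Local notation for Fourier space `ℝ³ = EuclideanSpace ℝ (Fin 3)`; `k 2` is the third
coordinate `k₃`. -/
local notation "ℝ³" => EuclideanSpace ℝ (Fin 3)

open LiSinai

/-! ### Triangular uniqueness of one-sided solutions of (1) -/

/-- **Slab propagation of the interaction integrand.** If at time `s` both fields vanish on
`{k₃ < a}` and agree on the slab `{k₃ < L}`, then their interaction integrands
`k' ↦ ⟨v(k-k',s),k⟩ P_k v(k',s)` of (1) agree at every wave vector `k` with `k₃ < L + a`: a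
summand is nonzero only if `k'₃ ≥ a` and `k₃ - k'₃ ≥ a`, and then `k'₃ < L` and `k₃ - k'₃ < L`.
[cite: LiSinai2008, §1 eq. (1) p. 268 and §2 p. 270 (supports)] -/
theorem fourierNSIntegrand_eq_of_eqOn_slab {v w : ℝ → ℝ³ → ℝ³} {a L s : ℝ}
    (hv : ∀ k : ℝ³, k 2 < a → v s k = 0) (hw : ∀ k : ℝ³, k 2 < a → w s k = 0)
    (heq : ∀ k : ℝ³, k 2 < L → v s k = w s k) {k : ℝ³} (hk : k 2 < L + a) :
    fourierNSIntegrand v s k = fourierNSIntegrand w s k := by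
  funext k'
  simp only [fourierNSIntegrand]
  have hsub : (k - k') 2 = k 2 - k' 2 := by simp
  by_cases h1 : k' 2 < a
  · rw [hv k' h1, hw k' h1, map_zero, smul_zero, smul_zero]
  by_cases h2 : (k - k') 2 < a
  · rw [hv (k - k') h2, hw (k - k') h2, inner_zero_left, zero_smul, zero_smul]
  push Not at h1 h2
  have hk' : k' 2 < L := by rw [hsub] at h2; linarith
  have hkk' : (k - k') 2 < L := by rw [hsub]; linarith
  rw [heq k' hk', heq (k - k') hkk']

/-- **Triangular uniqueness for Li–Sinai's equation (1) in the one-sided class.** Let `a > 0`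
and let `v, w : ℝ → ℝ³ → ℝ³` both vanish on `{k₃ < a}` at every `τ ∈ [0,t)`, have the same datum
`v(·,0) = w(·,0)`, and both solve the integral equation (1) (`SolvesFourierNSAt`, honest
integrals) at every `τ ∈ [0,t)` and every `k ≠ 0`. Then `v(·,τ) = w(·,τ)` for every
`τ ∈ [0,t)`. Induction on slabs `{k₃ < N a}`: on `{k₃ < a}` both vanish; if they agree on
`{k₃ < N a}` at all times of `[0,t)` then at `k` with `a ≤ k₃ < (N+1) a` (so `k ≠ 0`) the
right-hand sides of (1) for `v` and `w` have the same free term and, by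
`fourierNSIntegrand_eq_of_eqOn_slab`, the same Duhamel integrand at every `s ∈ [0,τ]`, hence
`v(k,τ) = w(k,τ)`. (Remark of this file; the source only ever considers the power series, whose
modes have `supp g_p ⊆ {k₃ ≥ p a}`.) [cite: LiSinai2008, §1 eq. (1) p. 268 and §2 p. 270] -/
theorem SolvesFourierNSAt.unique_of_oneSided {v w : ℝ → ℝ³ → ℝ³} {a t : ℝ} (ha : 0 < a)
    (hv : ∀ τ ∈ Ico 0 t, ∀ k : ℝ³, k 2 < a → v τ k = 0)
    (hw : ∀ τ ∈ Ico 0 t, ∀ k : ℝ³, k 2 < a → w τ k = 0) (h0 : ∀ k, v 0 k = w 0 k)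
    (hvs : ∀ τ ∈ Ico 0 t, ∀ k : ℝ³, k ≠ 0 → SolvesFourierNSAt v τ k)
    (hws : ∀ τ ∈ Ico 0 t, ∀ k : ℝ³, k ≠ 0 → SolvesFourierNSAt w τ k) :
    ∀ τ ∈ Ico 0 t, v τ = w τ := by
  suffices H : ∀ N : ℕ, ∀ τ ∈ Ico 0 t, ∀ k : ℝ³, k 2 < N * a → v τ k = w τ k by
    intro τ hτ
    funext k
    exact H _ τ hτ k (lt_floor_succ_mul ha (k 2))
  intro N
  induction N with
  | zero =>
    intro τ hτ k hk
    have hk' : k 2 < a := by simp at hk; linarith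
    rw [hv τ hτ k hk', hw τ hτ k hk']
  | succ N ih =>
    intro τ hτ k hk
    by_cases hka : k 2 < a
    · rw [hv τ hτ k hka, hw τ hτ k hka]
    have hk0 : k ≠ 0 := by
      rintro rfl
      exact hka (by simpa using ha)
    have hkNa : k 2 < N * a + a := by rw [Nat.cast_succ, add_mul, one_mul] at hk; exact hk
    obtain ⟨-, -, hv3⟩ := hvs τ hτ k hk0
    obtain ⟨-, -, hw3⟩ := hws τ hτ k hk0
    rw [hv3, hw3, h0 k]
    congr 1
    refine intervalIntegral.integral_congr fun s hs => ?_
    have hs' : s ∈ Ico 0 t := by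
      rw [uIcc_of_le hτ.1] at hs
      exact ⟨hs.1, hs.2.trans_lt hτ.2⟩
    rw [fourierNSIntegrand_eq_of_eqOn_slab (hv s hs') (hw s hs') (fun k' hk' => ih s hs' k' hk')
      hkNa]

/-- **Li–Sinai's power series is the unique one-sided solution.** Let the datum `v₀` be
measurable, bounded, and vanish off `{a ≤ k₃, |k| ≤ R}` with `a > 0`, and let `v` be ANY
solution of (1) on `[0,t)` (at every `τ ∈ [0,t)` and `k ≠ 0`) with `v(·,0) = v₀` which is
one-sided (`v(k,τ) = 0` for `k₃ < a`). Then `v(·,τ) = seriesSolution v₀ τ` for every `τ ∈ [0,t)`: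
the series is one-sided (`LiSinai.seriesSolution_eq_zero`), has datum `v₀`
(`LiSinai.seriesSolution_zero`) and solves (1) at all times
(`LiSinai.seriesSolution_solvesFourierNSAt`), so `SolvesFourierNSAt.unique_of_oneSided` applies.
[cite: LiSinai2008, §2 eqs. (3)–(6) p. 269–270] -/
theorem eq_seriesSolution_of_oneSided {v₀ : ℝ³ → ℝ³} {v : ℝ → ℝ³ → ℝ³} {a R M₀ t : ℝ}
    (ha : 0 < a) (hv₀m : Measurable v₀) (hv₀ : ∀ k, v₀ k ≠ 0 → a ≤ k 2 ∧ ‖k‖ ≤ R)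
    (hM₀ : ∀ k, ‖v₀ k‖ ≤ M₀) (h0 : v 0 = v₀)
    (hone : ∀ τ ∈ Ico 0 t, ∀ k : ℝ³, k 2 < a → v τ k = 0)
    (hsol : ∀ τ ∈ Ico 0 t, ∀ k : ℝ³, k ≠ 0 → SolvesFourierNSAt v τ k) :
    ∀ τ ∈ Ico 0 t, v τ = seriesSolution v₀ τ :=
  SolvesFourierNSAt.unique_of_oneSided ha hone
    (fun τ _ k hk => seriesSolution_eq_zero ha hv₀ hk τ)
    (fun k => by rw [h0, seriesSolution_zero])
    hsol (fun τ hτ k _ => seriesSolution_solvesFourierNSAt ha hv₀m hv₀ hM₀ hτ.1 k)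

/-! ### The exact residual of the barrier on Li–Sinai's class -/

/-- **The barrier fact from the energy profile of the series, in the fact's own form.** If for
one admissible datum (measurable, bounded, vanishing off `{a ≤ k₃, |k| ≤ R}` with `a > 0`,
incompressible) and one `t > 0` the explicit all-time solution `seriesSolution v₀` of (1) has
finite energy `∫ |v(k,τ)|² dk` at every `τ ∈ [0,t)` and energy tending to `+∞` as `τ ↑ t`, then
`ComplexNavierStokesBlowup` holds, with witness `(v₀, t, seriesSolution v₀)`. This weakens the
hypothesis of `LiSinaiSeriesEnergyBlowup.complexNavierStokesBlowup` (infinite energy AT `t`,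
which gives the left limit by Fatou) to exactly what the fact asks. [cite: LiSinai2008, §1
p. 268 and §10 p. 312] -/
theorem complexNavierStokesBlowup_of_seriesEnergy_tendsto {v₀ : ℝ³ → ℝ³} {a R t : ℝ}
    (ha : 0 < a) (ht : 0 < t) (hv₀m : Measurable v₀) (hbdd : ∃ M : ℝ, ∀ k, ‖v₀ k‖ ≤ M)
    (hv₀ : ∀ k, v₀ k ≠ 0 → a ≤ k 2 ∧ ‖k‖ ≤ R) (hdiv : ∀ k, ⟪v₀ k, k⟫ = 0)
    (hfin : ∀ τ ∈ Ico 0 t, ∫⁻ k, ‖seriesSolution v₀ τ k‖ₑ ^ 2 < ∞)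
    (hlim : Tendsto (fun τ => ∫⁻ k, ‖seriesSolution v₀ τ k‖ₑ ^ 2) (𝓝[<] t) (𝓝 ∞)) :
    ComplexNavierStokesBlowup := by
  obtain ⟨M₀, hM₀⟩ := hbdd
  refine ⟨v₀, t, seriesSolution v₀, ht, hv₀m, ?_, ⟨M₀, hM₀⟩, hdiv, seriesSolution_zero v₀, ?_, ?_,
    hlim⟩
  · refine HasCompactSupport.intro (isCompact_closedBall (0 : ℝ³) R) fun k hk => ?_
    by_contra h
    exact hk (mem_closedBall_zero_iff.2 (hv₀ k h).2)
  · intro τ hτ k _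
    exact seriesSolution_solvesFourierNSAt ha hv₀m hv₀ hM₀ hτ.1 k
  · intro τ hτ
    exact ⟨(measurable_seriesSolution ha hv₀m hv₀ τ).aemeasurable, hfin τ hτ⟩

/-- **On Li–Sinai's one-sided class the barrier fact is a statement about the explicit series.**
The following are equivalent: (i) `ComplexNavierStokesBlowup` has a witness `(v₀, t, v)` in
Li–Sinai's class — the datum vanishes off `{k₃ ≥ a}` for some `a > 0` (in the source: bounded
data supported in a neighbourhood of `(0,0,k⁽⁰⁾)`, §1 p. 268; the data (39), §7 p. 295) and the
solution is one-sided, `v(k,τ) = 0` for `k₃ < a`, `τ ∈ [0,t)` (as the power series is, §2 p. 270);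
(ii) for some admissible datum and some `t > 0` the energy of `seriesSolution v₀` is finite on
`[0,t)` and tends to `+∞` as `τ ↑ t`. (i) ⇒ (ii): the witness IS the series on `[0,t)`
(`eq_seriesSolution_of_oneSided`; a compactly supported datum vanishing off `{k₃ ≥ a}` vanishes
off some `{a ≤ k₃, |k| ≤ R}`); (ii) ⇒ (i): `complexNavierStokesBlowup_of_seriesEnergy_tendsto`
with the one-sidedness of the series. Either side implies `ComplexNavierStokesBlowup`
(`ComplexNavierStokesBlowup.of_oneSided_witness`). [cite: LiSinai2008, §1 p. 268, §2 p. 270 and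
§10 p. 312] -/
theorem complexNavierStokesBlowup_oneSided_iff :
    (∃ (v₀ : ℝ³ → ℝ³) (a t : ℝ) (v : ℝ → ℝ³ → ℝ³), 0 < a ∧ 0 < t ∧
      Measurable v₀ ∧ HasCompactSupport v₀ ∧ (∃ M : ℝ, ∀ k, ‖v₀ k‖ ≤ M) ∧ (∀ k, ⟪v₀ k, k⟫ = 0) ∧
      (∀ k, v₀ k ≠ 0 → a ≤ k 2) ∧ v 0 = v₀ ∧
      (∀ τ ∈ Ico 0 t, ∀ k : ℝ³, k 2 < a → v τ k = 0) ∧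
      (∀ τ ∈ Ico 0 t, ∀ k : ℝ³, k ≠ 0 → SolvesFourierNSAt v τ k) ∧
      (∀ τ ∈ Ico 0 t, AEMeasurable (v τ) ∧ ∫⁻ k, ‖v τ k‖ₑ ^ 2 < ∞) ∧
      Tendsto (fun τ => ∫⁻ k, ‖v τ k‖ₑ ^ 2) (𝓝[<] t) (𝓝 ∞)) ↔
    (∃ (v₀ : ℝ³ → ℝ³) (a R t : ℝ), 0 < a ∧ 0 < t ∧
      Measurable v₀ ∧ (∃ M : ℝ, ∀ k, ‖v₀ k‖ ≤ M) ∧ (∀ k, v₀ k ≠ 0 → a ≤ k 2 ∧ ‖k‖ ≤ R) ∧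
      (∀ k, ⟪v₀ k, k⟫ = 0) ∧
      (∀ τ ∈ Ico 0 t, ∫⁻ k, ‖seriesSolution v₀ τ k‖ₑ ^ 2 < ∞) ∧
      Tendsto (fun τ => ∫⁻ k, ‖seriesSolution v₀ τ k‖ₑ ^ 2) (𝓝[<] t) (𝓝 ∞)) := by
  constructor
  · rintro ⟨v₀, a, t, v, ha, ht, hv₀m, hcs, ⟨M₀, hM₀⟩, hdiv, hone₀, h0, hone, hsol, hfin, hlim⟩
    -- a compactly supported datum vanishing off `{k₃ ≥ a}` is admissible for some `R`
    obtain ⟨R, hR⟩ := hcs.isCompact.isBounded.subset_closedBall (0 : ℝ³)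
    have hv₀ : ∀ k, v₀ k ≠ 0 → a ≤ k 2 ∧ ‖k‖ ≤ R := fun k hk =>
      ⟨hone₀ k hk, mem_closedBall_zero_iff.1 (hR (subset_tsupport _ (Function.mem_support.2 hk)))⟩
    -- the witness is the series on `[0,t)`
    have heq : ∀ τ ∈ Ico 0 t, v τ = seriesSolution v₀ τ :=
      eq_seriesSolution_of_oneSided ha hv₀m hv₀ hM₀ h0 hone hsol
    refine ⟨v₀, a, R, t, ha, ht, hv₀m, ⟨M₀, hM₀⟩, hv₀, hdiv, fun τ hτ => ?_, ?_⟩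
    · rw [← heq τ hτ]; exact (hfin τ hτ).2
    · refine Tendsto.congr' (eventuallyEq_of_mem (Ico_mem_nhdsLT ht) fun τ hτ => ?_) hlim
      simp only [heq τ hτ]
  · rintro ⟨v₀, a, R, t, ha, ht, hv₀m, ⟨M₀, hM₀⟩, hv₀, hdiv, hfin, hlim⟩
    refine ⟨v₀, a, t, seriesSolution v₀, ha, ht, hv₀m, ?_, ⟨M₀, hM₀⟩, hdiv, fun k hk => (hv₀ k hk).1,
      seriesSolution_zero v₀, fun τ _ k hk => seriesSolution_eq_zero ha hv₀ hk τ, ?_, ?_, hlim⟩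
    · refine HasCompactSupport.intro (isCompact_closedBall (0 : ℝ³) R) fun k hk => ?_
      by_contra h
      exact hk (mem_closedBall_zero_iff.2 (hv₀ k h).2)
    · intro τ hτ k _
      exact seriesSolution_solvesFourierNSAt ha hv₀m hv₀ hM₀ hτ.1 k
    · intro τ hτ
      exact ⟨(measurable_seriesSolution ha hv₀m hv₀ τ).aemeasurable, hfin τ hτ⟩

/-- **A one-sided witness of the barrier fact, read off as the barrier fact** (forgetting the
one-sidedness): convenience projection of the left-hand side of
`complexNavierStokesBlowup_oneSided_iff`. [folklore] -/
theorem ComplexNavierStokesBlowup.of_oneSided_witness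
    (h : ∃ (v₀ : ℝ³ → ℝ³) (a t : ℝ) (v : ℝ → ℝ³ → ℝ³), 0 < a ∧ 0 < t ∧
      Measurable v₀ ∧ HasCompactSupport v₀ ∧ (∃ M : ℝ, ∀ k, ‖v₀ k‖ ≤ M) ∧ (∀ k, ⟪v₀ k, k⟫ = 0) ∧
      (∀ k, v₀ k ≠ 0 → a ≤ k 2) ∧ v 0 = v₀ ∧
      (∀ τ ∈ Ico 0 t, ∀ k : ℝ³, k 2 < a → v τ k = 0) ∧
      (∀ τ ∈ Ico 0 t, ∀ k : ℝ³, k ≠ 0 → SolvesFourierNSAt v τ k) ∧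
      (∀ τ ∈ Ico 0 t, AEMeasurable (v τ) ∧ ∫⁻ k, ‖v τ k‖ₑ ^ 2 < ∞) ∧
      Tendsto (fun τ => ∫⁻ k, ‖v τ k‖ₑ ^ 2) (𝓝[<] t) (𝓝 ∞)) :
    ComplexNavierStokesBlowup := by
  obtain ⟨v₀, a, R, t, ha, ht, hv₀m, hbdd, hv₀, hdiv, hfin, hlim⟩ :=
    complexNavierStokesBlowup_oneSided_iff.1 h
  exact complexNavierStokesBlowup_of_seriesEnergy_tendsto ha ht hv₀m hbdd hv₀ hdiv hfin hlim

/-! ### Restarting solutions of (1): the Duhamel algebra of a time shift -/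

/-- **Duhamel algebra of a time shift (interval integrability).** If
`σ ↦ e^{-(t₀+τ-σ)c} F(σ)` is interval integrable on `[0, t₀+τ]` (`t₀, τ ≥ 0`), then the shifted
Duhamel integrand `s ↦ e^{-(τ-s)c} F(t₀+s)` is interval integrable on `[0, τ]`. [folklore] -/
theorem duhamelShift_intervalIntegrable {F : ℝ → ℝ³} {c t₀ τ : ℝ} (ht₀ : 0 ≤ t₀) (hτ : 0 ≤ τ)
    (hi : IntervalIntegrable (fun σ => Real.exp (-(t₀ + τ - σ) * c) • F σ) volume 0 (t₀ + τ)) :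
    IntervalIntegrable (fun s => Real.exp (-(τ - s) * c) • F (t₀ + s)) volume 0 τ := by
  have hG2 : IntervalIntegrable (fun σ => Real.exp (-(t₀ + τ - σ) * c) • F σ) volume t₀ (t₀ + τ) :=
    hi.mono_set (by
      rw [uIcc_of_le (by linarith : t₀ ≤ t₀ + τ), uIcc_of_le (by linarith : (0 : ℝ) ≤ t₀ + τ)]
      exact Icc_subset_Icc ht₀ le_rfl)
  have h2 := hG2.comp_add_left t₀
  rw [sub_self, add_sub_cancel_left] at h2
  have hfun : (fun x => Real.exp (-(t₀ + τ - (t₀ + x)) * c) • F (t₀ + x)) =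
      fun s => Real.exp (-(τ - s) * c) • F (t₀ + s) := by
    funext s
    congr 2
    ring
  rw [← hfun]
  exact h2

/-- **Duhamel algebra of a time shift (the identity).** With `c = |k|²`, if
`x(t₀) = e^{-t₀ c} x₀ + ∫₀^{t₀} e^{-(t₀-σ)c} F(σ) dσ` and
`x(t₀+τ) = e^{-(t₀+τ)c} x₀ + ∫₀^{t₀+τ} e^{-(t₀+τ-σ)c} F(σ) dσ` (the latter integrand interval
integrable), then `x(t₀+τ) = e^{-τ c} x(t₀) + ∫₀^τ e^{-(τ-s)c} F(t₀+s) ds`: split the second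
integral at `t₀`, factor `e^{-τ c}` out of the first piece and translate the second (the
semigroup property of the heat factor). [folklore] -/
theorem duhamelShift_eq {F : ℝ → ℝ³} {c t₀ τ : ℝ} {x₀ xt₀ xt : ℝ³} (ht₀ : 0 ≤ t₀) (hτ : 0 ≤ τ)
    (hi : IntervalIntegrable (fun σ => Real.exp (-(t₀ + τ - σ) * c) • F σ) volume 0 (t₀ + τ))
    (h₀ : xt₀ = Real.exp (-t₀ * c) • x₀ + ∫ σ in (0 : ℝ)..t₀, Real.exp (-(t₀ - σ) * c) • F σ)
    (h₁ : xt = Real.exp (-(t₀ + τ) * c) • x₀ +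
      ∫ σ in (0 : ℝ)..(t₀ + τ), Real.exp (-(t₀ + τ - σ) * c) • F σ) :
    xt = Real.exp (-τ * c) • xt₀ +
      ∫ s in (0 : ℝ)..τ, Real.exp (-(τ - s) * c) • F (t₀ + s) := by
  have hG1 : IntervalIntegrable (fun σ => Real.exp (-(t₀ + τ - σ) * c) • F σ) volume 0 t₀ :=
    hi.mono_set (by
      rw [uIcc_of_le ht₀, uIcc_of_le (by linarith : (0 : ℝ) ≤ t₀ + τ)]
      exact Icc_subset_Icc le_rfl (by linarith))
  have hG2 : IntervalIntegrable (fun σ => Real.exp (-(t₀ + τ - σ) * c) • F σ) volume t₀ (t₀ + τ) :=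
    hi.mono_set (by
      rw [uIcc_of_le (by linarith : t₀ ≤ t₀ + τ), uIcc_of_le (by linarith : (0 : ℝ) ≤ t₀ + τ)]
      exact Icc_subset_Icc ht₀ le_rfl)
  -- the first piece: factor out `e^{-τ c}`
  have hfirst : ∫ σ in (0 : ℝ)..t₀, Real.exp (-(t₀ + τ - σ) * c) • F σ =
      Real.exp (-τ * c) • ∫ σ in (0 : ℝ)..t₀, Real.exp (-(t₀ - σ) * c) • F σ := by
    rw [← intervalIntegral.integral_smul]
    refine intervalIntegral.integral_congr fun σ _ => ?_
    simp only [smul_smul, ← Real.exp_add]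
    congr 1
    ring
  -- the second piece: translate `σ = t₀ + s`
  have hsecond : ∫ s in (0 : ℝ)..τ, Real.exp (-(τ - s) * c) • F (t₀ + s) =
      ∫ σ in t₀..(t₀ + τ), Real.exp (-(t₀ + τ - σ) * c) • F σ := by
    have h := intervalIntegral.integral_comp_add_left
      (fun σ => Real.exp (-(t₀ + τ - σ) * c) • F σ) t₀ (a := 0) (b := τ)
    rw [add_zero] at h
    rw [← h]
    refine intervalIntegral.integral_congr fun s _ => ?_
    congr 2
    ring
  rw [h₁, ← intervalIntegral.integral_add_adjacent_intervals hG1 hG2, hfirst, ← hsecond, h₀, smul_add,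
    smul_smul, ← Real.exp_add, show -τ * c + -t₀ * c = -(t₀ + τ) * c by ring]
  abel

/-- **Restarting a solution of (1) at an intermediate time.** If `v` satisfies Li–Sinai's
integral equation (1) at the wave vector `k` at the times `t₀ ≥ 0` and `t₀ + τ`, `τ ≥ 0` (both
counted from time `0`), then the shifted field `s ↦ v(·, t₀ + s)` satisfies (1) at `k` at time
`τ` with datum `v(·, t₀)`: `v(k,t₀+τ) = e^{-τ|k|²} v(k,t₀) + ∫₀^τ e^{-(τ-s)|k|²}
∫ ⟨v(k-k',t₀+s),k⟩ P_k v(k',t₀+s) dk' ds`, with the same honest-integral clauses (the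
interaction integrand of the shifted field at time `s` is that of `v` at time `t₀ + s`).
[cite: LiSinai2008, §1 eq. (1) p. 268] -/
theorem SolvesFourierNSAt.shift {v : ℝ → ℝ³ → ℝ³} {t₀ τ : ℝ} {k : ℝ³} (ht₀ : 0 ≤ t₀)
    (hτ : 0 ≤ τ) (h₀ : SolvesFourierNSAt v t₀ k) (h₁ : SolvesFourierNSAt v (t₀ + τ) k) :
    SolvesFourierNSAt (fun s => v (t₀ + s)) τ k := by
  obtain ⟨-, -, h₀e⟩ := h₀
  obtain ⟨h₁I, h₁i, h₁e⟩ := h₁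
  refine ⟨fun s hs => ?_, ?_, ?_⟩
  · exact h₁I (t₀ + s) ⟨by linarith [hs.1], by linarith [hs.2]⟩
  · exact duhamelShift_intervalIntegrable (F := fun σ => ∫ k', fourierNSIntegrand v σ k k')
      (c := ‖k‖ ^ 2) ht₀ hτ h₁i
  · have h := duhamelShift_eq (F := fun σ => ∫ k', fourierNSIntegrand v σ k k') (c := ‖k‖ ^ 2)
      ht₀ hτ h₁i h₀e h₁e
    show v (t₀ + τ) k = Real.exp (-τ * ‖k‖ ^ 2) • v (t₀ + 0) k +
      ∫ s in (0 : ℝ)..τ, Real.exp (-(τ - s) * ‖k‖ ^ 2) • ∫ k', fourierNSIntegrand v (t₀ + s) k k'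
    rw [add_zero]
    exact h

/-- **Transfer of (1) along equal interaction integrands.** If `w` satisfies (1) at `(s, k)` and
`v` has the same interaction integrand at `k` at every time, the same value at `(s,k)` and the
same datum at `k`, then `v` satisfies (1) at `(s, k)`. [folklore] -/
theorem SolvesFourierNSAt.of_integrand_eq {v w : ℝ → ℝ³ → ℝ³} {s : ℝ} {k : ℝ³}
    (h : SolvesFourierNSAt w s k)
    (H : ∀ (σ : ℝ) (k' : ℝ³), fourierNSIntegrand v σ k k' = fourierNSIntegrand w σ k k')
    (hs : v s k = w s k) (h0 : v 0 k = w 0 k) : SolvesFourierNSAt v s k := by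
  obtain ⟨h1, h2, h3⟩ := h
  refine ⟨fun σ hσ => ?_, ?_, ?_⟩
  · have hf : fourierNSIntegrand v σ k = fourierNSIntegrand w σ k := funext (H σ)
    rw [hf]
    exact h1 σ hσ
  · simp only [H]
    exact h2
  · rw [hs, h0]
    simp only [H]
    exact h3

namespace LiSinai

/-! ### Locality of the power series and the restart (semigroup) law -/

/-- **Locality of the modes.** If `w` agrees on the slab `{k₃ < L}` (`L ≥ 0`) with a datum `w'`
vanishing off `{a ≤ k₃, |k| ≤ R}`, `a > 0`, then every mode of `w` agrees with the corresponding
mode of `w'` on that slab, at every time: in the Duhamel pair at `k` with `k₃ < L` a factor is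
nonzero only if both arguments `k'`, `k - k'` lie below `L` (where the induction hypothesis
applies) — if `k'₃ ≥ L` then `(k-k')₃ < 0`, and if `(k-k')₃ ≥ L` then `k'₃ < 0`, and modes of
`w'` vanish below `a` (`supp g_p ⊆ {k₃ ≥ p a}`). So on the slab `{k₃ < L}` the modes depend on
the datum only through its restriction to that slab.
[cite: LiSinai2008, §2 eqs. (4)–(6) p. 269 and p. 270 (supports)] -/
theorem mode_congr_below {w w' : ℝ³ → ℝ³} {a R L : ℝ} (ha : 0 < a) (hL : 0 ≤ L)
    (hw' : ∀ k, w' k ≠ 0 → a ≤ k 2 ∧ ‖k‖ ≤ R) (hagree : ∀ k : ℝ³, k 2 < L → w k = w' k) :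
    ∀ (p : ℕ) (s : ℝ) (k : ℝ³), k 2 < L → mode w p s k = mode w' p s k := by
  intro p
  induction p using Nat.strong_induction_on with
  | _ p ih =>
  intro s k hk
  rcases p with _ | _ | m
  · simp [mode_zero]
  · show mode w 1 s k = mode w' 1 s k
    rw [mode_one, mode_one, hagree k hk]
  · show mode w (m + 2) s k = mode w' (m + 2) s k
    rw [mode_add_two, mode_add_two]
    refine Finset.sum_congr rfl fun i _ => ?_
    have hi2 := i.2
    -- the two interaction integrands agree at `k` (all times `s'`, all `k'`)
    have hpair : pairIntegrand (mode w (i.1 + 1)) (mode w (m - i.1 + 1)) k =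
        pairIntegrand (mode w' (i.1 + 1)) (mode w' (m - i.1 + 1)) k := by
      funext s' k'
      simp only [pairIntegrand]
      have hsub : (k - k') 2 = k 2 - k' 2 := by simp
      by_cases h1 : k' 2 < L
      · by_cases h2 : (k - k') 2 < L
        · rw [ih _ (by omega) s' k' h1, ih _ (by omega) s' (k - k') h2]
        · -- `(k-k')₃ ≥ L > k₃`: `k'₃ < 0 < a`, the second factor vanishes on both sides
          have hk'0 : k' 2 < a := by push Not at h2; rw [hsub] at h2; linarith
          rw [ih _ (by omega) s' k' h1, mode_eq_zero_of_lt_a ha hw' hk'0, map_zero, smul_zero,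
            smul_zero]
      · -- `k'₃ ≥ L > k₃`: `(k-k')₃ < 0 ≤ L` and `< a`, the first factor vanishes on both sides
        push Not at h1
        have h2 : (k - k') 2 < L := by rw [hsub]; linarith
        have h3 : (k - k') 2 < a := by rw [hsub]; linarith
        rw [ih _ (by omega) s' (k - k') h2, mode_eq_zero_of_lt_a ha hw' h3, inner_zero_left,
          zero_smul, zero_smul]
    unfold duhamelPair
    rw [hpair]

/-- **Locality of the series**: under the hypotheses of `mode_congr_below` the power series of `w`
and of `w'` agree on `{k₃ < L}` at every time. [cite: LiSinai2008, §2 eq. (3) p. 269] -/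
theorem seriesSolution_congr_below {w w' : ℝ³ → ℝ³} {a R L : ℝ} (ha : 0 < a) (hL : 0 ≤ L)
    (hw' : ∀ k, w' k ≠ 0 → a ≤ k 2 ∧ ‖k‖ ≤ R) (hagree : ∀ k : ℝ³, k 2 < L → w k = w' k)
    (s : ℝ) {k : ℝ³} (hk : k 2 < L) : seriesSolution w s k = seriesSolution w' s k := by
  unfold seriesSolution
  exact tsum_congr fun p => mode_congr_below ha hL hw' hagree p s k hk

/-- **Truncations of a time slice of the series are admissible data.** For an admissible datum
`v₀` (measurable, bounded, vanishing off `{a ≤ k₃, |k| ≤ R}`, `a > 0`) and `t₀ ≥ 0`, the slice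
`w = seriesSolution v₀ t₀` truncated to the slab `{k₃ < L}` is again admissible: measurable,
bounded (below `L < N a` the series is the sum of the `N` modes of order `< N`, uniformly bounded
on `[0, t₀]` by `mode_bound`), vanishing off `{a ≤ k₃, |k| ≤ N max(R,0)}` (`mode_support`), and
it agrees with `w` on `{k₃ < L}`. [cite: LiSinai2008, §2 p. 270] -/
theorem indicator_seriesSolution_admissible {v₀ : ℝ³ → ℝ³} {a R M₀ t₀ : ℝ} (ha : 0 < a)
    (hv₀m : Measurable v₀) (hv₀ : ∀ k, v₀ k ≠ 0 → a ≤ k 2 ∧ ‖k‖ ≤ R) (hM₀ : ∀ k, ‖v₀ k‖ ≤ M₀)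
    (ht₀ : 0 ≤ t₀) (L : ℝ) :
    Measurable ({k : ℝ³ | k 2 < L}.indicator (seriesSolution v₀ t₀)) ∧
    (∃ M : ℝ, ∀ k, ‖{k : ℝ³ | k 2 < L}.indicator (seriesSolution v₀ t₀) k‖ ≤ M) ∧
    (∃ R' : ℝ, ∀ k, {k : ℝ³ | k 2 < L}.indicator (seriesSolution v₀ t₀) k ≠ 0 →
      a ≤ k 2 ∧ ‖k‖ ≤ R') ∧
    (∀ k : ℝ³, k 2 < L → seriesSolution v₀ t₀ k = {k : ℝ³ | k 2 < L}.indicator (seriesSolution v₀ t₀) k) := by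
  have hmeas : MeasurableSet {k : ℝ³ | k 2 < L} := measurableSet_lt (by fun_prop) measurable_const
  set N : ℕ := ⌊L / a⌋₊ + 1 with hN
  have hLN : L < (N : ℝ) * a := lt_floor_succ_mul ha L
  obtain ⟨M, hM0, hb⟩ := mode_bound hv₀ hM₀ t₀ N
  -- below `L` the series is the sum of the first `N` modes
  have hsum : ∀ k : ℝ³, k 2 < L →
      seriesSolution v₀ t₀ k = ∑ p ∈ Finset.range N, mode v₀ p t₀ k :=
    fun k hk => seriesSolution_eq_sum ha hv₀ (hk.trans hLN) t₀
  refine ⟨(measurable_seriesSolution ha hv₀m hv₀ t₀).indicator hmeas, ⟨N * M, fun k => ?_⟩,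
    ⟨N * max R 0, fun k hk => ?_⟩, fun k hk => (indicator_of_mem (by exact hk) _).symm⟩
  · by_cases hk : k 2 < L
    · rw [indicator_of_mem (by exact hk), hsum k hk]
      calc ‖∑ p ∈ Finset.range N, mode v₀ p t₀ k‖ ≤ ∑ p ∈ Finset.range N, ‖mode v₀ p t₀ k‖ :=
            norm_sum_le _ _
        _ ≤ ∑ _p ∈ Finset.range N, M :=
            Finset.sum_le_sum fun p hp =>
              hb p (Finset.mem_range.1 hp).le t₀ ⟨ht₀, le_rfl⟩ k
        _ = N * M := by simp
    · rw [indicator_of_notMem (by exact hk), norm_zero]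
      positivity
  · have hkL : k 2 < L := by
      by_contra h
      exact hk (indicator_of_notMem (by exact h) _)
    rw [indicator_of_mem (by exact hkL)] at hk
    refine ⟨?_, ?_⟩
    · by_contra h
      exact hk (seriesSolution_eq_zero ha hv₀ (not_le.1 h) t₀)
    · rw [hsum k hkL] at hk
      obtain ⟨p, hp, hpk⟩ := Finset.exists_ne_zero_of_sum_ne_zero hk
      have hpN : (p : ℝ) ≤ N := by exact_mod_cast (Finset.mem_range.1 hp).le
      calc ‖k‖ ≤ p * R := (mode_support hv₀ p t₀ k hpk).2
        _ ≤ p * max R 0 := mul_le_mul_of_nonneg_left (le_max_left _ _) p.cast_nonneg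
        _ ≤ N * max R 0 := mul_le_mul_of_nonneg_right hpN (le_max_right _ _)

/-- **The restarted series vanishes below `a`.** For an admissible datum and `t₀ ≥ 0`, the power
series issued from the slice `seriesSolution v₀ t₀` vanishes on `{k₃ < a}` at every time (locality
+ `seriesSolution_eq_zero` for the admissible truncation). [cite: LiSinai2008, §2 p. 270] -/
theorem seriesSolution_restart_eq_zero {v₀ : ℝ³ → ℝ³} {a R M₀ t₀ : ℝ} (ha : 0 < a)
    (hv₀m : Measurable v₀) (hv₀ : ∀ k, v₀ k ≠ 0 → a ≤ k 2 ∧ ‖k‖ ≤ R) (hM₀ : ∀ k, ‖v₀ k‖ ≤ M₀)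
    (ht₀ : 0 ≤ t₀) (s : ℝ) {k : ℝ³} (hk : k 2 < a) :
    seriesSolution (seriesSolution v₀ t₀) s k = 0 := by
  obtain ⟨-, -, ⟨R', hR'⟩, hagree⟩ := indicator_seriesSolution_admissible ha hv₀m hv₀ hM₀ ht₀ a
  rw [seriesSolution_congr_below ha ha.le hR' hagree s hk]
  exact seriesSolution_eq_zero ha hR' hk s

/-- **The restarted series solves (1).** For an admissible datum `v₀` and `t₀ ≥ 0`, the power
series issued from the slice `w = seriesSolution v₀ t₀` — a datum which is neither bounded nor
compactly supported, but agrees below every height `L` with an admissible truncation — satisfies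
Li–Sinai's equation (1) at every time `s ≥ 0` and every wave vector `k`: at `k` the three clauses
of (1) only involve the series below the height `|k₃| + a`, where it is the series of the
truncation (`seriesSolution_congr_below`), which solves (1) (`seriesSolution_solvesFourierNSAt`).
[cite: LiSinai2008, §1 eq. (1) p. 268 and §2 p. 269–270] -/
theorem seriesSolution_restart_solvesFourierNSAt {v₀ : ℝ³ → ℝ³} {a R M₀ t₀ : ℝ} (ha : 0 < a)
    (hv₀m : Measurable v₀) (hv₀ : ∀ k, v₀ k ≠ 0 → a ≤ k 2 ∧ ‖k‖ ≤ R) (hM₀ : ∀ k, ‖v₀ k‖ ≤ M₀)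
    (ht₀ : 0 ≤ t₀) {s : ℝ} (hs : 0 ≤ s) (k : ℝ³) :
    SolvesFourierNSAt (seriesSolution (seriesSolution v₀ t₀)) s k := by
  set L : ℝ := |k 2| + a with hL
  have habs : 0 ≤ |k 2| := abs_nonneg _
  have hle : k 2 ≤ |k 2| := le_abs_self _
  have hL0 : 0 ≤ L := by rw [hL]; linarith
  obtain ⟨hm', ⟨M', hM'⟩, ⟨R', hR'⟩, hagree⟩ :=
    indicator_seriesSolution_admissible ha hv₀m hv₀ hM₀ ht₀ L
  -- locality: the series of the slice and of its truncation agree below `L`, at all times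
  have hloc : ∀ (σ : ℝ) (k'' : ℝ³), k'' 2 < L → seriesSolution (seriesSolution v₀ t₀) σ k'' =
      seriesSolution ({k : ℝ³ | k 2 < L}.indicator (seriesSolution v₀ t₀)) σ k'' :=
    fun σ k'' hk'' => seriesSolution_congr_below ha hL0 hR' hagree σ hk''
  have hw'0 : ∀ (σ : ℝ) (k'' : ℝ³), k'' 2 < a →
      seriesSolution ({k : ℝ³ | k 2 < L}.indicator (seriesSolution v₀ t₀)) σ k'' = 0 :=
    fun σ k'' hk'' => seriesSolution_eq_zero ha hR' hk'' σ
  have hw0 : ∀ (σ : ℝ) (k'' : ℝ³), k'' 2 < a → seriesSolution (seriesSolution v₀ t₀) σ k'' = 0 :=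
    fun σ k'' hk'' => seriesSolution_restart_eq_zero ha hv₀m hv₀ hM₀ ht₀ σ hk''
  have hkLa : k 2 < L + a := by rw [hL]; linarith
  have hkL : k 2 < L := by rw [hL]; linarith
  have H : ∀ σ, fourierNSIntegrand (seriesSolution (seriesSolution v₀ t₀)) σ k =
      fourierNSIntegrand (seriesSolution ({k : ℝ³ | k 2 < L}.indicator (seriesSolution v₀ t₀))) σ k :=
    fun σ => fourierNSIntegrand_eq_of_eqOn_slab (hw0 σ) (hw'0 σ) (hloc σ) hkLa
  exact (seriesSolution_solvesFourierNSAt ha hm' hR' hM' hs k).of_integrand_eq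
    (fun σ k' => congrFun (H σ) k') (hloc s k hkL) (hloc 0 k hkL)

/-- **The series solves (1) from any intermediate time** (`SolvesFourierNSAt.shift` applied to
`seriesSolution_solvesFourierNSAt`): for `t₀, s ≥ 0` and every `k`, the shifted series
`s ↦ seriesSolution v₀ (t₀ + s)` satisfies (1) at `(s, k)` with datum `seriesSolution v₀ t₀`.
[cite: LiSinai2008, §1 eq. (1) p. 268 and §2 p. 269–270] -/
theorem seriesSolution_shift_solvesFourierNSAt {v₀ : ℝ³ → ℝ³} {a R M₀ t₀ : ℝ} (ha : 0 < a)
    (hv₀m : Measurable v₀) (hv₀ : ∀ k, v₀ k ≠ 0 → a ≤ k 2 ∧ ‖k‖ ≤ R) (hM₀ : ∀ k, ‖v₀ k‖ ≤ M₀)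
    (ht₀ : 0 ≤ t₀) {s : ℝ} (hs : 0 ≤ s) (k : ℝ³) :
    SolvesFourierNSAt (fun σ => seriesSolution v₀ (t₀ + σ)) s k :=
  SolvesFourierNSAt.shift ht₀ hs (seriesSolution_solvesFourierNSAt ha hv₀m hv₀ hM₀ ht₀ k)
    (seriesSolution_solvesFourierNSAt ha hv₀m hv₀ hM₀ (by linarith) k)

/-- **Restart (semigroup) law of Li–Sinai's power series.** For an admissible datum `v₀`
(measurable, bounded, vanishing off `{a ≤ k₃, |k| ≤ R}`, `a > 0`) and `t₀, τ ≥ 0`,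
`seriesSolution v₀ (t₀ + τ) = seriesSolution (seriesSolution v₀ t₀) τ`: the power series
re-expanded around the time-`t₀` slice reproduces the solution. Both sides are one-sided
solutions of (1) on `[0, τ+1)` with the same datum `seriesSolution v₀ t₀`
(`seriesSolution_shift_solvesFourierNSAt`, `seriesSolution_restart_solvesFourierNSAt`,
`seriesSolution_restart_eq_zero`), so triangular uniqueness
(`SolvesFourierNSAt.unique_of_oneSided`) applies. In particular the singular set
`{τ : ∫ |seriesSolution v₀ τ k|² dk = ∞}` transforms as that of an autonomous flow under
`v₀ ↦ seriesSolution v₀ t₀`. (Remark of this file; the source expands around `t = 0` only.)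
[cite: LiSinai2008, §2 eqs. (3)–(6) p. 269–270] -/
theorem seriesSolution_add {v₀ : ℝ³ → ℝ³} {a R M₀ : ℝ} (ha : 0 < a) (hv₀m : Measurable v₀)
    (hv₀ : ∀ k, v₀ k ≠ 0 → a ≤ k 2 ∧ ‖k‖ ≤ R) (hM₀ : ∀ k, ‖v₀ k‖ ≤ M₀) {t₀ τ : ℝ}
    (ht₀ : 0 ≤ t₀) (hτ : 0 ≤ τ) :
    seriesSolution v₀ (t₀ + τ) = seriesSolution (seriesSolution v₀ t₀) τ := by
  have hτ' : τ ∈ Ico 0 (τ + 1) := ⟨hτ, by linarith⟩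
  refine SolvesFourierNSAt.unique_of_oneSided (v := fun s => seriesSolution v₀ (t₀ + s))
    (w := seriesSolution (seriesSolution v₀ t₀)) (t := τ + 1) ha ?_ ?_ ?_ ?_ ?_ τ hτ'
  · intro σ _ k hk
    exact seriesSolution_eq_zero ha hv₀ hk (t₀ + σ)
  · intro σ _ k hk
    exact seriesSolution_restart_eq_zero ha hv₀m hv₀ hM₀ ht₀ σ hk
  · intro k
    show seriesSolution v₀ (t₀ + 0) k = _
    rw [add_zero, seriesSolution_zero]
  · intro σ hσ k _
    exact seriesSolution_shift_solvesFourierNSAt ha hv₀m hv₀ hM₀ ht₀ hσ.1 k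
  · intro σ hσ k _
    exact seriesSolution_restart_solvesFourierNSAt ha hv₀m hv₀ hM₀ ht₀ hσ.1 k

end LiSinai

end Literature.Barriers.NavierStokesRegularity
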